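import Mathlib
import Literature.NumberTheory.LFunctions.KloostermanQuadraticTwist
import Literature.Combinatorics.SimpleGraph.PaleyT441Fourier
import HarnessLib

/-!
# Kunisky–Yu `T^{4,4,1}`, step 3a: the frequency-one block factors through Kloosterman sums — PROVED

Topic `Literature/Combinatorics/SimpleGraph` (support for `kuniskyYu2022_theorem_1_2`).
Frequency `r = 1` of the Paley pair kernel `g_{s,t}(u) = χ(u)χ(u−t)χ(u+s)χ(u+s−t)` is the form
`∑_{s,t} y_s conj(y_t) ∑_u g_{s,t}(u) e(u/p)`.  Writing `g_{s,t}(u) = φ_t(u) φ_t(u + s)` with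
`φ_t(x) = χ(x)χ(x − t)` and expanding `y` in additive characters (Kunisky–Yu (129)–(130): "there is
a unitary matrix `U` given by a row and column permutation of the discrete Fourier transform
matrix such that `T = p^{-1/2} T⁽¹⁾ U`, where `T⁽¹⁾_{ij} = K(i²j²) K((i+1)²j²)`"), we prove the
identity (`paleyKernel_oneFreq_form_eq`)

  `form₁(y) = p⁻¹ ∑_r ŷ(r) ∑_t conj(y_t) e(t/2) K((rt/4)²) K(((1−r)t/4)²)`,
  `ŷ(r) = ∑_s y_s e(−rs)`,   `K = S(1, ·; p)`,

using `∑_x χ(x(x−t)) e(rx) = e(rt/2) K((rt/4)²)`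
(`Literature.NumberTheory.LFunctions.sum_quadraticChar_mul_sub_mul_stdAddChar`), and deduce by
Cauchy–Schwarz and Parseval (`norm_paleyKernel_oneFreq_form_le_of_sq_bound`): a mean-square bound
`∑_r |∑_t z_t K((rt/4)²)K(((1−r)t/4)²)|² ≤ B ∑_t |z_t|²` (all `z` with `z_0 = 0`) gives
`|form₁(y)| ≤ (B/p)^{1/2} ∑_s |y_s|²`.  The mean-square bound is the business of
`PaleyT441M1Gram.lean` (Gershgorin on `T⁽²⁾T⁽²⁾ᵀ` plus the Fouvry–Kowalski–Michel estimate).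

## References

* D. Kunisky, X. Yu, arXiv:2211.02713 (2022), Theorem 4.20, (129)–(132).  [KuniskyYu2022]
-/

noncomputable section

open Finset
open Literature.NumberTheory.LFunctions

namespace Literature.Combinatorics.SimpleGraph

section OneFreq

variable {p : ℕ} [hp : Fact p.Prime]

/-- The Paley pair kernel splits as `g_{s,t}(u) = φ_t(u) φ_t(u+s)`, `φ_t(x) = χ(x) χ(x − t)`.
[cite: KuniskyYu2022, Theorem 4.20 (127)] -/
theorem paleyKernel_eq_mul (s t u : ZMod p) :
    ((quadraticChar (ZMod p) u : ℤ) : ℂ) * ((quadraticChar (ZMod p) (u - t) : ℤ) : ℂ) *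
        ((quadraticChar (ZMod p) (u + s) : ℤ) : ℂ) *
        ((quadraticChar (ZMod p) (u + s - t) : ℤ) : ℂ) =
      (((quadraticChar (ZMod p) (u * (u - t)) : ℤ) : ℂ)) *
        (((quadraticChar (ZMod p) ((u + s) * (u + s - t)) : ℤ) : ℂ)) := by
  rw [map_mul, map_mul]
  push_cast
  ring

/-- Fourier inversion against a shifted function:
`∑_s y_s φ(u + s) = p⁻¹ ∑_r ŷ(r) e(−ru) Φ(r)`, `ŷ(r) = ∑_s y_s e(−rs)`, `Φ(r) = ∑_w φ(w) e(rw)`.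
[folklore] -/
theorem sum_mul_shift_eq_fourier (y φ : ZMod p → ℂ) (u : ZMod p) :
    ∑ s : ZMod p, y s * φ (u + s) =
      (p : ℂ)⁻¹ * ∑ r : ZMod p, (∑ s : ZMod p, y s * ZMod.stdAddChar (-(r * s))) *
        ZMod.stdAddChar (-(r * u)) * (∑ w : ZMod p, φ w * ZMod.stdAddChar (r * w)) := by
  classical
  have h := sum_sum_kernel_sub_eq y (fun c => if c = -u then (1 : ℂ) else 0) φ
  have hL : ∑ a : ZMod p, ∑ c : ZMod p, y a * (if c = -u then (1 : ℂ) else 0) * φ (a - c) =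
      ∑ s : ZMod p, y s * φ (u + s) := by
    refine Finset.sum_congr rfl fun a _ => ?_
    simp_rw [mul_ite, mul_one, mul_zero, ite_mul, zero_mul]
    rw [Finset.sum_ite_eq' Finset.univ (-u)]
    simp only [Finset.mem_univ, if_true, sub_neg_eq_add, add_comm a u]
  have hM : ∀ r : ZMod p, ∑ c : ZMod p, (if c = -u then (1 : ℂ) else 0) * ZMod.stdAddChar (r * c) =
      ZMod.stdAddChar (-(r * u)) := by
    intro r
    simp_rw [ite_mul, one_mul, zero_mul]
    rw [Finset.sum_ite_eq' Finset.univ (-u)]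
    simp only [Finset.mem_univ, if_true, mul_neg]
  rw [← hL, h]
  congr 1
  refine Finset.sum_congr rfl fun r _ => ?_
  rw [hM r]

/-- **The frequency-one block through Kloosterman sums** (Kunisky–Yu (129)–(130)): for `p` odd
and `y : 𝔽_p → ℂ` with `y_0 = 0`,
`∑_{s,t} y_s conj(y_t) ∑_u g_{s,t}(u) e(u) = p⁻¹ ∑_r ŷ(r) ∑_t conj(y_t) e(t/2) K((rt/4)²) K(((1−r)t/4)²)`.
[cite: KuniskyYu2022, Theorem 4.20] -/
theorem paleyKernel_oneFreq_form_eq (hp2 : p ≠ 2) (y : ZMod p → ℂ) (hy : y 0 = 0) :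
    ∑ s : ZMod p, ∑ t : ZMod p, y s * (starRingEnd ℂ) (y t) *
        ∑ u : ZMod p, ((quadraticChar (ZMod p) u : ℤ) : ℂ) *
          ((quadraticChar (ZMod p) (u - t) : ℤ) : ℂ) *
          ((quadraticChar (ZMod p) (u + s) : ℤ) : ℂ) *
          ((quadraticChar (ZMod p) (u + s - t) : ℤ) : ℂ) * ZMod.stdAddChar u =
      (p : ℂ)⁻¹ * ∑ r : ZMod p, (∑ s : ZMod p, y s * ZMod.stdAddChar (-(r * s))) *
        ∑ t : ZMod p, (starRingEnd ℂ) (y t) * ZMod.stdAddChar (t / 2) *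
          kloostermanSum p 1 ((r * t / 4) ^ 2) * kloostermanSum p 1 (((1 - r) * t / 4) ^ 2) := by
  classical
  -- notation inside the proof
  set φ : ZMod p → ZMod p → ℂ := fun t x => ((quadraticChar (ZMod p) (x * (x - t)) : ℤ) : ℂ)
    with hφ
  set Φ : ZMod p → ZMod p → ℂ := fun t r => ∑ w : ZMod p, φ t w * ZMod.stdAddChar (r * w) with hΦ
  set yh : ZMod p → ℂ := fun r => ∑ s : ZMod p, y s * ZMod.stdAddChar (-(r * s)) with hyh
  -- Step 1: kernel split and the sum over `s` in Fourier form
  have hst : ∀ s t : ZMod p, ∑ u : ZMod p, ((quadraticChar (ZMod p) u : ℤ) : ℂ) *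
      ((quadraticChar (ZMod p) (u - t) : ℤ) : ℂ) *
      ((quadraticChar (ZMod p) (u + s) : ℤ) : ℂ) *
      ((quadraticChar (ZMod p) (u + s - t) : ℤ) : ℂ) * ZMod.stdAddChar u =
      ∑ u : ZMod p, φ t u * ZMod.stdAddChar u * φ t (u + s) := by
    intro s t
    refine Finset.sum_congr rfl fun u _ => ?_
    rw [paleyKernel_eq_mul, hφ]
    ring
  simp_rw [hst]
  -- for fixed `t`: `∑_s y_s ∑_u φ_t(u) e(u) φ_t(u+s) = p⁻¹ ∑_r ŷ(r) Φ_t(r) Φ_t(1-r)`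
  have hfix : ∀ t : ZMod p, ∑ s : ZMod p, y s * ∑ u : ZMod p, φ t u * ZMod.stdAddChar u * φ t (u + s) =
      (p : ℂ)⁻¹ * ∑ r : ZMod p, yh r * (Φ t r * Φ t (1 - r)) := by
    intro t
    -- swap `s` and `u`, apply Fourier inversion in `s`
    have h1 : ∑ s : ZMod p, y s * ∑ u : ZMod p, φ t u * ZMod.stdAddChar u * φ t (u + s) =
        ∑ u : ZMod p, φ t u * ZMod.stdAddChar u * ∑ s : ZMod p, y s * φ t (u + s) := by
      simp_rw [Finset.mul_sum]
      rw [Finset.sum_comm]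
      refine Finset.sum_congr rfl fun u _ => Finset.sum_congr rfl fun s _ => ?_
      ring
    rw [h1]
    simp_rw [sum_mul_shift_eq_fourier y (φ t)]
    -- now `∑_u φ_t(u) e(u) (p⁻¹ ∑_r ŷ(r) e(-ru) Φ_t(r)) = p⁻¹ ∑_r ŷ(r) Φ_t(r) ∑_u φ_t(u) e((1-r)u)`
    have h2 : ∀ u : ZMod p, φ t u * ZMod.stdAddChar u *
        ((p : ℂ)⁻¹ * ∑ r : ZMod p, yh r * ZMod.stdAddChar (-(r * u)) * Φ t r) =
        (p : ℂ)⁻¹ * ∑ r : ZMod p, yh r * Φ t r * (φ t u * ZMod.stdAddChar ((1 - r) * u)) := by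
      intro u
      rw [Finset.mul_sum, Finset.mul_sum, Finset.mul_sum]
      refine Finset.sum_congr rfl fun r _ => ?_
      have he : (ZMod.stdAddChar u : ℂ) * ZMod.stdAddChar (-(r * u)) =
          ZMod.stdAddChar ((1 - r) * u) := by
        rw [← AddChar.map_add_eq_mul]
        congr 1
        ring
      rw [← he]
      ring
    have h2' : ∀ u : ZMod p, φ t u * ZMod.stdAddChar u *
        ((p : ℂ)⁻¹ * ∑ r : ZMod p, (∑ s : ZMod p, y s * ZMod.stdAddChar (-(r * s))) *
          ZMod.stdAddChar (-(r * u)) * ∑ w : ZMod p, φ t w * ZMod.stdAddChar (r * w)) =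
        (p : ℂ)⁻¹ * ∑ r : ZMod p, yh r * Φ t r * (φ t u * ZMod.stdAddChar ((1 - r) * u)) := by
      intro u
      rw [← h2 u]
    simp_rw [h2']
    rw [← Finset.mul_sum]
    congr 1
    rw [Finset.sum_comm]
    refine Finset.sum_congr rfl fun r _ => ?_
    rw [← Finset.mul_sum, mul_assoc]
  -- Step 2: assemble over `t`
  have hform : ∑ s : ZMod p, ∑ t : ZMod p, y s * (starRingEnd ℂ) (y t) *
      ∑ u : ZMod p, φ t u * ZMod.stdAddChar u * φ t (u + s) =
      (p : ℂ)⁻¹ * ∑ r : ZMod p, yh r * ∑ t : ZMod p, (starRingEnd ℂ) (y t) * (Φ t r * Φ t (1 - r)) := by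
    rw [Finset.sum_comm]
    have h3 : ∀ t : ZMod p, ∑ s : ZMod p, y s * (starRingEnd ℂ) (y t) *
        ∑ u : ZMod p, φ t u * ZMod.stdAddChar u * φ t (u + s) =
        (starRingEnd ℂ) (y t) * ((p : ℂ)⁻¹ * ∑ r : ZMod p, yh r * (Φ t r * Φ t (1 - r))) := by
      intro t
      rw [← hfix t, Finset.mul_sum]
      refine Finset.sum_congr rfl fun s _ => ?_
      ring
    simp_rw [h3]
    simp_rw [Finset.mul_sum]
    rw [Finset.sum_comm]
    refine Finset.sum_congr rfl fun r _ => ?_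
    refine Finset.sum_congr rfl fun t _ => ?_
    ring
  rw [hform]
  -- Step 3: `conj(y_t) Φ_t(r) Φ_t(1-r) = conj(y_t) e(t/2) K((rt/4)²) K(((1-r)t/4)²)` (for `t = 0`
  -- both sides vanish because `y 0 = 0`)
  congr 1
  refine Finset.sum_congr rfl fun r _ => ?_
  congr 1
  refine Finset.sum_congr rfl fun t _ => ?_
  by_cases ht : t = 0
  · rw [ht, hy, map_zero]
    ring
  have hΦt : ∀ r' : ZMod p, Φ t r' =
      ZMod.stdAddChar (r' * t / 2) * kloostermanSum p 1 ((r' * t / 4) ^ 2) := by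
    intro r'
    rw [hΦ, hφ]
    exact sum_quadraticChar_mul_sub_mul_stdAddChar hp2 ht r'
  rw [hΦt r, hΦt (1 - r)]
  have he : (ZMod.stdAddChar (r * t / 2) : ℂ) * ZMod.stdAddChar ((1 - r) * t / 2) =
      ZMod.stdAddChar (t / 2) := by
    rw [← AddChar.map_add_eq_mul]
    congr 1
    ring
  rw [← he]
  ring

/-- **Mean-square reduction** (Kunisky–Yu (132)–(133), "we may then bound the norm of our
original `T` as `‖T‖² = p⁻¹ ‖T⁽¹⁾‖²`"): if
`∑_r |∑_t z_t K((rt/4)²) K(((1−r)t/4)²)|² ≤ B ∑_t |z_t|²` for all `z` with `z_0 = 0`, then the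
frequency-one form is bounded by `(B/p)^{1/2} ∑_s |y_s|²`. [cite: KuniskyYu2022, Theorem 4.20] -/
theorem norm_paleyKernel_oneFreq_form_le_of_sq_bound (hp2 : p ≠ 2) {B : ℝ} (hB : 0 ≤ B)
    (hsq : ∀ z : ZMod p → ℂ, z 0 = 0 →
      ∑ r : ZMod p, ‖∑ t : ZMod p, z t * kloostermanSum p 1 ((r * t / 4) ^ 2) *
        kloostermanSum p 1 (((1 - r) * t / 4) ^ 2)‖ ^ 2 ≤ B * ∑ t : ZMod p, ‖z t‖ ^ 2)
    (y : ZMod p → ℂ) (hy : y 0 = 0) :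
    ‖∑ s : ZMod p, ∑ t : ZMod p, y s * (starRingEnd ℂ) (y t) *
        ∑ u : ZMod p, ((quadraticChar (ZMod p) u : ℤ) : ℂ) *
          ((quadraticChar (ZMod p) (u - t) : ℤ) : ℂ) *
          ((quadraticChar (ZMod p) (u + s) : ℤ) : ℂ) *
          ((quadraticChar (ZMod p) (u + s - t) : ℤ) : ℂ) * ZMod.stdAddChar u‖ ≤
      Real.sqrt B / Real.sqrt p * ∑ s : ZMod p, ‖y s‖ ^ 2 := by
  classical
  have hp0 : (0 : ℝ) < p := by exact_mod_cast hp.out.pos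
  rw [paleyKernel_oneFreq_form_eq hp2 y hy, norm_mul, norm_inv, Complex.norm_natCast]
  -- the two vectors paired by Cauchy–Schwarz
  set yh : ZMod p → ℂ := fun r => ∑ s : ZMod p, y s * ZMod.stdAddChar (-(r * s)) with hyh
  set z : ZMod p → ℂ := fun t => (starRingEnd ℂ) (y t) * ZMod.stdAddChar (t / 2) with hz
  set c : ZMod p → ℂ := fun r => ∑ t : ZMod p, z t * kloostermanSum p 1 ((r * t / 4) ^ 2) *
    kloostermanSum p 1 (((1 - r) * t / 4) ^ 2) with hc
  have hz0 : z 0 = 0 := by rw [hz]; simp [hy]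
  have hznorm : ∑ t : ZMod p, ‖z t‖ ^ 2 = ∑ t : ZMod p, ‖y t‖ ^ 2 := by
    refine Finset.sum_congr rfl fun t _ => ?_
    rw [hz]
    simp only [norm_mul, Complex.norm_conj, norm_stdAddChar, mul_one]
  -- Cauchy–Schwarz
  set X : ℝ := ‖∑ r : ZMod p, yh r * c r‖ with hX
  set Y : ℝ := ∑ s : ZMod p, ‖y s‖ ^ 2 with hY
  have hY0 : 0 ≤ Y := Finset.sum_nonneg fun s _ => by positivity
  have hX0 : 0 ≤ X := norm_nonneg _
  have hCS : X ^ 2 ≤ (∑ r : ZMod p, ‖yh r‖ ^ 2) * ∑ r : ZMod p, ‖c r‖ ^ 2 := by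
    have h1 : X ≤ ∑ r : ZMod p, ‖yh r‖ * ‖c r‖ := by
      rw [hX]
      refine (norm_sum_le _ _).trans (Finset.sum_le_sum fun r _ => ?_)
      rw [norm_mul]
    have h2 : (∑ r : ZMod p, ‖yh r‖ * ‖c r‖) ^ 2 ≤
        (∑ r : ZMod p, ‖yh r‖ ^ 2) * ∑ r : ZMod p, ‖c r‖ ^ 2 :=
      Finset.sum_mul_sq_le_sq_mul_sq _ _ _
    calc X ^ 2 ≤ (∑ r : ZMod p, ‖yh r‖ * ‖c r‖) ^ 2 := by gcongr
      _ ≤ _ := h2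
  -- Parseval and the mean-square hypothesis
  have hpars : ∑ r : ZMod p, ‖yh r‖ ^ 2 = (p : ℝ) * Y := by
    rw [hyh, hY]
    exact sum_norm_sq_fourier_eq y
  have hcsq : ∑ r : ZMod p, ‖c r‖ ^ 2 ≤ B * Y := by
    rw [← hznorm]
    exact hsq z hz0
  have hX2 : X ^ 2 ≤ ((p : ℝ) * B) * Y ^ 2 := by
    calc X ^ 2 ≤ (∑ r : ZMod p, ‖yh r‖ ^ 2) * ∑ r : ZMod p, ‖c r‖ ^ 2 := hCS
      _ ≤ ((p : ℝ) * Y) * (B * Y) := by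
          rw [hpars]
          exact mul_le_mul_of_nonneg_left hcsq (by positivity)
      _ = ((p : ℝ) * B) * Y ^ 2 := by ring
  have hXle : X ≤ Real.sqrt ((p : ℝ) * B) * Y := by
    have h1 : X = Real.sqrt (X ^ 2) := (Real.sqrt_sq hX0).symm
    rw [h1]
    calc Real.sqrt (X ^ 2) ≤ Real.sqrt (((p : ℝ) * B) * Y ^ 2) := Real.sqrt_le_sqrt hX2
      _ = Real.sqrt ((p : ℝ) * B) * Y := by
          rw [Real.sqrt_mul (by positivity), Real.sqrt_sq hY0]
  -- conclude: `p⁻¹ X ≤ √B / √p · Y`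
  have hsplit : Real.sqrt ((p : ℝ) * B) = Real.sqrt p * Real.sqrt B := Real.sqrt_mul hp0.le B
  have hsp : 0 < Real.sqrt p := Real.sqrt_pos.mpr hp0
  have hpsq : (p : ℝ) = Real.sqrt p * Real.sqrt p := (Real.mul_self_sqrt hp0.le).symm
  change (p : ℝ)⁻¹ * X ≤ Real.sqrt B / Real.sqrt p * Y
  rw [hsplit] at hXle
  calc (p : ℝ)⁻¹ * X ≤ (p : ℝ)⁻¹ * (Real.sqrt p * Real.sqrt B * Y) :=
        mul_le_mul_of_nonneg_left hXle (by positivity)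
    _ = Real.sqrt B / Real.sqrt p * Y := by
        rw [show (p : ℝ)⁻¹ = (Real.sqrt p)⁻¹ * (Real.sqrt p)⁻¹ by rw [← mul_inv, ← hpsq]]
        field_simp

end OneFreq

end Literature.Combinatorics.SimpleGraph

end
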